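import Literature.AnabelianGeometry.AbsoluteAnabelian.LocalClassFieldTheoryForms
import Literature.AnabelianGeometry.AbsoluteAnabelian.LocalReciprocityCompletionProofs
import Literature.NumberTheory.GaloisRepresentations.GaloisCohomologyKummerProofs
import Literature.NumberTheory.GaloisRepresentations.LocalGlobalCohomologyFiniteProofs
import HarnessLib

/-!
# LCFT form L5 of [FrdII] §2 — `H¹(G_K, μ_n) ≅ G_K^{ab}/n` from the completed reciprocity map
# (proof-only companion of `LocalClassFieldTheoryForms.lean`)

Node `LCFT:Facts` of the abc-iut DAG (typer abc-iut-L4-t4, p404656).  Form L5 there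
(`mlf_H1_mu_equiv_abelianization_mod`, [FrdII] p. 18: "by the well-known duality theory of
nonarchimedean [...] local fields [cf. [NSW], Chapter 7, Theorem 7.2.6], the cup product on group
cohomology determines an isomorphism `H¹(H, μ_N(A)) ≅ H^{ab} ⊗ H²(H, μ_N(A))`", for `H = G_K`:
`H¹(G_K, μ_n) ≅ G_K^{ab} ⊗ ℤ/n`) is DERIVED here from form L1 (`mlf_reciprocity_completion`,
`(K^×)^∧ ≅ G_K^{ab}`):

* `mlf_H1_mu_equiv_abelianization_mod_of_reciprocity_completion :
    mlf_reciprocity_completion → mlf_H1_mu_equiv_abelianization_mod`.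

Proof.  Kummer theory `H¹(K, μ_n) ≅ K^×/(K^×)^n` (tree `kummerEquiv`, every field with `n ≠ 0`)
and the finiteness of `K^×/(K^×)^n` (tree `finite_quotient_range_powMonoidHom_units`, Hensel)
reduce L5 to `G_K^{ab}/(G_K^{ab})^n ≅ K^×/(K^×)^n`.  For this only the topological-group
isomorphism `e : (K^×)^∧ ≃ G_K^{ab}` of L1 is used (none of the finer reciprocity properties):
`P = (K^×)^n` is a finite-index subgroup, so the profinite completion `(K^×)^∧` projects
continuously onto the finite discrete group `K^×/P` (coordinate `P` of Mathlib's
`ProfiniteGrp.ProfiniteCompletion.completion`), compatibly with `η : K^× → (K^×)^∧`; the kernel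
`W ⊆ G_K^{ab}` of the induced surjection `f : G_K^{ab} → K^×/P` is open, contains
`(G_K^{ab})^n` (the target has exponent `n`), and is contained in the closed subgroup
`(G_K^{ab})^n` because `e ∘ η` has dense image (`ProfiniteCompletion.denseRange`) and
`W ∩ (e ∘ η)(K^×) = (e ∘ η)(P) ⊆ (G_K^{ab})^n`.  Hence `G_K^{ab}/(G_K^{ab})^n ≅ K^×/P`.
With L1 discharged (`mlf_reciprocity_completion_holds`, in progress elsewhere in the cell) this
gives `mlf_H1_mu_equiv_abelianization_mod` unconditionally by one application.  No definitions.
-/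

noncomputable section

universe u

namespace Literature.AnabelianGeometry.AbsoluteAnabelian

open Field CategoryTheory
open ProfiniteGrp.ProfiniteCompletion
open Literature.NumberTheory.GaloisRepresentations

/-- **L5 from L1**: the completed reciprocity isomorphism `(K^×)^∧ ≅ G_K^{ab}`
(`mlf_reciprocity_completion`) yields `H¹(G_K, μ_n) ≃+ G_K^{ab}/(G_K^{ab})^n`
(`mlf_H1_mu_equiv_abelianization_mod`) for every non-archimedean local field `K` of
characteristic `0` and `n ≥ 1`, through Kummer theory `H¹(K, μ_n) ≅ K^×/(K^×)^n` and the
identification `(K^×)^∧/((K^×)^∧)^n-level = K^×/(K^×)^n` at the finite-index coordinate `(K^×)^n`.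
[cite: MochizukiFrdII2008, §2 p.18] -/
theorem mlf_H1_mu_equiv_abelianization_mod_of_reciprocity_completion
    (hL1 : mlf_reciprocity_completion.{u}) : mlf_H1_mu_equiv_abelianization_mod.{u} := by
  intro K _ _ _ _ _ n _
  classical
  have hn0 : (n : K) ≠ 0 := Nat.cast_ne_zero.2 (NeZero.ne n)
  haveI : NeZero (n : K) := ⟨hn0⟩
  obtain ⟨e, -⟩ := hL1 K
  haveI : IsClosed ((commutator (absoluteGaloisGroup K)).topologicalClosure :
      Set (absoluteGaloisGroup K)) := Subgroup.isClosed_topologicalClosure _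
  -- `P = (K^×)^n`, a finite-index (normal) subgroup of `K^×`
  let P : Subgroup Kˣ := (powMonoidHom n : Kˣ →* Kˣ).range
  haveI hPfin : Finite (Kˣ ⧸ P) := by
    letI : UniformSpace K := IsTopologicalAddGroup.rightUniformSpace K
    haveI : IsUniformAddGroup K := isUniformAddGroup_of_addCommGroup
    exact finite_quotient_range_powMonoidHom_units K n hn0
  haveI : P.FiniteIndex := Subgroup.finiteIndex_of_finite_quotient
  let P' : FiniteIndexNormalSubgroup Kˣ := FiniteIndexNormalSubgroup.ofSubgroup P
  -- the coordinate projection `(K^×)^∧ → K^×/P` and the canonical map `η`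
  let η : Kˣ →* completion (GrpCat.of Kˣ) := (eta (GrpCat.of Kˣ)).hom
  let π : completion (GrpCat.of Kˣ) →* Kˣ ⧸ P :=
    { toFun := fun x => x.1 P'
      map_one' := rfl
      map_mul' := fun _ _ => rfl }
  have hπη : ∀ g : Kˣ, π (η g) = QuotientGroup.mk g := fun _ => rfl
  have hπopen : IsOpen (π.ker : Set (completion (GrpCat.of Kˣ))) := by
    have hc : Continuous fun x : completion (GrpCat.of Kˣ) => x.1 P' :=
      (continuous_apply P').comp continuous_subtype_val
    letI : DiscreteTopology ((diagram (GrpCat.of Kˣ)).obj P') := ⟨rfl⟩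
    have : (π.ker : Set (completion (GrpCat.of Kˣ))) =
        (fun x : completion (GrpCat.of Kˣ) => x.1 P') ⁻¹' {1} := by
      ext x
      simp only [SetLike.mem_coe, MonoidHom.mem_ker, Set.mem_preimage, Set.mem_singleton_iff]
      rfl
    rw [this]
    exact (isOpen_discrete _).preimage hc
  have hπsurj : Function.Surjective π := fun q => by
    obtain ⟨g, rfl⟩ := QuotientGroup.mk_surjective q
    exact ⟨η g, hπη g⟩
  have hdense : DenseRange (fun g : Kˣ => e (η g)) :=
    e.surjective.denseRange.comp (denseRange (GrpCat.of Kˣ)) e.continuous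
  -- `f = π ∘ e⁻¹ : G_K^ab → K^×/P`, a surjection with kernel `(G_K^ab)^n`
  let f : absoluteGaloisGroupAbelianization K →* Kˣ ⧸ P := π.comp e.symm.toMulEquiv.toMonoidHom
  have hf_apply : ∀ a, f a = π (e.symm a) := fun _ => rfl
  have hfsurj : Function.Surjective f := hπsurj.comp e.symm.surjective
  have hker : f.ker = (powMonoidHom n : absoluteGaloisGroupAbelianization K →*
      absoluteGaloisGroupAbelianization K).range := by
    apply le_antisymm
    · intro a ha
      have hclosed : IsClosed ((powMonoidHom n : absoluteGaloisGroupAbelianization K →*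
          absoluteGaloisGroupAbelianization K).range :
            Set (absoluteGaloisGroupAbelianization K)) := by
        have hset : ((powMonoidHom n : absoluteGaloisGroupAbelianization K →*
            absoluteGaloisGroupAbelianization K).range :
              Set (absoluteGaloisGroupAbelianization K)) =
            Set.range fun x : absoluteGaloisGroupAbelianization K => x ^ n := by
          ext x
          simp only [SetLike.mem_coe, MonoidHom.mem_range, powMonoidHom_apply, Set.mem_range]
        rw [hset]
        exact (isCompact_range (continuous_pow n)).isClosed
      have hWopen : IsOpen (f.ker : Set (absoluteGaloisGroupAbelianization K)) := by
        have hset : (f.ker : Set (absoluteGaloisGroupAbelianization K)) =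
            e.symm ⁻¹' (π.ker : Set (completion (GrpCat.of Kˣ))) := by
          ext x
          simp only [SetLike.mem_coe, MonoidHom.mem_ker, Set.mem_preimage, hf_apply]
        rw [hset]
        exact hπopen.preimage e.symm.continuous
      have h1 : (f.ker : Set (absoluteGaloisGroupAbelianization K)) ⊆
          closure ((f.ker : Set (absoluteGaloisGroupAbelianization K)) ∩
            Set.range fun g : Kˣ => e (η g)) :=
        hdense.open_subset_closure_inter hWopen
      have h2 : (f.ker : Set (absoluteGaloisGroupAbelianization K)) ∩
            Set.range (fun g : Kˣ => e (η g)) ⊆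
          ((powMonoidHom n : absoluteGaloisGroupAbelianization K →*
            absoluteGaloisGroupAbelianization K).range :
              Set (absoluteGaloisGroupAbelianization K)) := by
        rintro _ ⟨hk, g, rfl⟩
        have hk' : π (η g) = 1 := by
          rw [SetLike.mem_coe, MonoidHom.mem_ker, hf_apply, ContinuousMulEquiv.symm_apply_apply]
            at hk
          exact hk
        rw [hπη, QuotientGroup.eq_one_iff] at hk'
        obtain ⟨h, rfl⟩ := hk'
        refine ⟨e (η h), ?_⟩
        change e (η h) ^ n = e (η (h ^ n))
        rw [map_pow, map_pow]
      exact closure_minimal h2 hclosed (h1 ha)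
    · rintro _ ⟨a, rfl⟩
      rw [MonoidHom.mem_ker, powMonoidHom_apply, map_pow]
      obtain ⟨g, hg⟩ := QuotientGroup.mk_surjective (f a)
      rw [← hg, ← QuotientGroup.mk_pow, QuotientGroup.eq_one_iff]
      exact ⟨g, rfl⟩
  -- `G_K^ab/(G_K^ab)^n ≃* K^×/P`, and Kummer
  let ι : absoluteGaloisGroupAbelianization K ⧸ (powMonoidHom n :
      absoluteGaloisGroupAbelianization K →* absoluteGaloisGroupAbelianization K).range ≃*
        Kˣ ⧸ P :=
    (QuotientGroup.quotientMulEquivOfEq hker.symm).trans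
      (QuotientGroup.quotientKerEquivOfSurjective f hfsurj)
  exact ⟨(kummerEquiv K n).trans (MulEquiv.toAdditive ι.symm)⟩

/-- **Discharge of LCFT form L5** `mlf_H1_mu_equiv_abelianization_mod` ([FrdII] §2 p. 18,
`H¹(G_K, μ_n) ≅ G_K^{ab} ⊗ ℤ/n` for non-archimedean local fields of characteristic `0`),
unconditionally: form L1 is proved in the tree (`mlf_reciprocity_completion_holds`, abc-iut-L4-d1,
from the tree's local class field theory) and L5 follows from it
(`mlf_H1_mu_equiv_abelianization_mod_of_reciprocity_completion`).
[cite: MochizukiFrdII2008, §2 p.18] -/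
theorem mlf_H1_mu_equiv_abelianization_mod_holds : mlf_H1_mu_equiv_abelianization_mod.{u} :=
  mlf_H1_mu_equiv_abelianization_mod_of_reciprocity_completion mlf_reciprocity_completion_holds

end Literature.AnabelianGeometry.AbsoluteAnabelian
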